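import Literature.Analysis.ValidatedNumerics.TaylorModelIntegralCertFamily
import HarnessLib

/-!
# The absolute value in Taylor-model integral certificates

Trunk T-ANA (Analysis/ValidatedNumerics); namespace `Literature.Analysis.ValidatedNumerics.PolyMP`.
The univariate approximation interface of CoqInterval / CoqApprox (Martin-Dorel–Melquiond, JAR 57 (2015/16),
Sect. 4.3.3, Fig. 3) combines approximations by the arithmetic operations, the elementary functions **and the absolute
value** (`abs : U → I → T → T` next to `exp`, …), over a data type `T ::= Dummy | Const I | Var | Tm (I[X] × I)` whose
degenerate members stand for functions with no usable polynomial part.  For `|g|` this is all one can do where the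
enclosure of `g` contains `0` (Mahboubi–Melquiond–Sibut-Pinote, JAR 62 (2019), Sect. 6.1, fourth problem: "there is a
point where the integrand is not differentiable because of the absolute value. Thus only degenerate Taylor models can
be computed around that point" — the integration tactic isolates it by domain splitting); elsewhere `|g| = g` or
`|g| = −g` keeps the full model.  This file adds exactly that statement to the kernel lane:

* `tabsTM S h G` with **`tmem_abs`** — the Taylor model of `|g|` from a model `G` of `g` on `|ρ| ≤ h`: `G` itself when
  the range bound certifies `g ≥ 0` (`0 ≤ tlowerI`), `−G` when it certifies `g ≤ 0` (`tupperI ≤ 0`), and otherwise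
  the DEGENERATE model of degree `0` with constant coefficient `[0, sup |g|]` (`tabsI`); sound with NO acceptance
  condition;
* `AbsOp Op` — the statements of ANY family `Op` plus one more, `abs i` (push `|vᵢ|`); `AbsOp.model` / `AbsOp.evalF` /
  **`AbsOp.tmem_model`**; the family transformer **`OpModel.withAbs M`** / **`OpSem.withAbs F`**, so that the generic
  certificates `M.withAbs.certCheck` / `M.withAbs.panelCheck` of `TaylorModelIntegralCertFamily.lean` and their
  soundness theorems `F.withAbs.integral_bounds_of_certCheck` / `F.withAbs.fsegOK_of_panelCheck` apply verbatim to
  integrands with absolute values over every family of the library (`SOp`, `TOp`, `AOp`; plain, sharp or wide modellers);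
* `toFunP_withAbs_map` — a program without `abs` statements denotes the same function in `M.withAbs` as in `M`.

Problem-independent plumbing; no facts, no axioms.

## References

* É. Martin-Dorel, G. Melquiond, *Proving tight bounds on univariate expressions with elementary functions in Coq*,
  J. Automated Reasoning 57 (2016) 187–217: Sect. 4.3.3 and Fig. 3 (the `UnivariateApprox` interface: `abs` among the
  approximation combinators; the type `T` with the degenerate constructors `Dummy` / `Const`).
  [cite: MartindorelMelquiond2015, Sect. 4.3.3]
* A. Mahboubi, G. Melquiond, T. Sibut-Pinote, *Formally verified approximations of definite integrals*,
  J. Automated Reasoning 62 (2019) 281–300: Sect. 6.1, fourth problem (`∫₀¹ |x⁴+10x³+19x²−6x−6| eˣ dx`: degenerate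
  Taylor models around the zero of the polynomial part, domain splitting to isolate it).
  [cite: MahboubiMelquiondSibutpinote2018, Sect. 6.1]
* G. Melquiond, *Proving bounds on real-valued functions with computations*, IJCAR 2008, LNCS 5195, 2–17, Sect. 3.3
  (straight-line programs; the evaluator generic in the operations). [cite: Melquiond2008, Sect. 3.3]
* M. Joldeş, *Rigorous Polynomial Approximations and Applications*, PhD thesis, ENS Lyon (2011): Algorithm 2.2.10
  (Taylor models of an expression by structural recursion). [cite: Joldes2011, Algorithm 2.2.10]
-/

open MeasureTheory intervalIntegral Set

namespace Literature.Analysis.ValidatedNumerics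

namespace PolyMP

open Literature.Analysis.ValidatedNumerics.NumericsMP
open Literature.Analysis.ValidatedNumerics.ExpPoly (Poly BPoly)
open Literature.Analysis.ValidatedNumerics.ExpPoly

/-! ### The Taylor model of `|g|` -/

/-- **Taylor model of `|g|`** from a model `G` of `g` on `|ρ| ≤ h`: `G` if the range bound certifies `g ≥ 0`, `−G` if
it certifies `g ≤ 0`, otherwise (the enclosure of `g` contains `0`, where `|·|` has no derivative) the degenerate
model of degree `0` with constant coefficient `[0, sup |g|]`.
[cite: MartindorelMelquiond2015, Sect. 4.3.3] [cite: MahboubiMelquiondSibutpinote2018, Sect. 6.1] -/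
def tabsTM (S : ℕ) (h : ℚ) (G : IPoly) : IPoly :=
  if 0 ≤ tlowerI S h G then G
  else if tupperI S h G ≤ 0 then tnegI G
  else tconst ⟨0, tabsI S h G⟩

/-- **Soundness of `tabsTM`** (no acceptance condition): if `G` encloses `g` on `|ρ| ≤ h`, then `tabsTM S h G`
encloses `|g|` there. [cite: MartindorelMelquiond2015, Sect. 4.3.3] -/
theorem tmem_abs {S : ℕ} (hS : 0 < S) {h : ℚ} (h0 : 0 ≤ h) {g : ℝ → ℝ} {G : IPoly} (hg : TMem S h g G) :
    TMem S h (fun ρ => |g ρ|) (tabsTM S h G) := by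
  have hSr : (0 : ℝ) < S := by exact_mod_cast hS
  unfold tabsTM
  split_ifs with hlo hhi
  · intro ρ hρ
    have h1 := tlowerI_le h0 hg hρ
    have h2 : (0 : ℝ) ≤ ((tlowerI S h G : ℤ) : ℝ) := by exact_mod_cast hlo
    have hg0 : 0 ≤ g ρ := le_of_mul_le_mul_right (by rw [zero_mul]; exact h2.trans h1) hSr
    obtain ⟨as, has, ef⟩ := hg ρ hρ
    exact ⟨as, has, by show |g ρ| = evalR as ρ; rw [abs_of_nonneg hg0, ef]⟩
  · intro ρ hρ
    have h1 := le_tupperI h0 hg hρ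
    have h2 : ((tupperI S h G : ℤ) : ℝ) ≤ 0 := by exact_mod_cast hhi
    have hg0 : g ρ ≤ 0 := le_of_mul_le_mul_right (by rw [zero_mul]; exact h1.trans h2) hSr
    obtain ⟨as, has, ef⟩ := tmem_neg hg ρ hρ
    exact ⟨as, has, by show |g ρ| = evalR as ρ; rw [abs_of_nonpos hg0]; exact ef⟩
  · intro ρ hρ
    have hb := abs_le_tabsI h0 hg hρ
    refine ⟨[|g ρ|], pmem_cons ⟨?_, hb⟩ (pmem_nil S), by simp⟩
    push_cast
    positivity

/-! ### Statements with `|·|` over any family -/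

/-- The statements of a family `Op` extended by one more statement type: `abs i` pushes `|vᵢ|` (stack-relative
operand, as every statement). [cite: MartindorelMelquiond2015, Sect. 4.3.3] [cite: Melquiond2008, Sect. 3.3] -/
inductive AbsOp (Op : Type) : Type
  /-- a statement of the underlying family -/
  | base (op : Op) : AbsOp Op
  /-- push `|vᵢ|` -/
  | abs (i : ℕ) : AbsOp Op

namespace AbsOp

/-- default statement (for `getReg`-style total lookups): `abs 0`. [cite: Melquiond2008, Sect. 3.3] -/
instance (Op : Type) : Inhabited (AbsOp Op) := ⟨abs 0⟩

variable {M : OpModel}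

/-- **The statement modeller**: the family's own for a `base` statement, `tabsTM` of the operand's register model for
`abs` (no candidate consumed, always accepted). [cite: Joldes2011, Algorithm 2.2.10] [cite: MartindorelMelquiond2015, Sect. 4.3.3] -/
def model (M : OpModel) (prm : M.Prm) (S : ℕ) (h : ℚ) (c : ℚ) (Ws : List IPoly) :
    AbsOp M.Op → List (List ℤ × ℕ) → WExpr.MRes
  | base op, cs => M.model prm S h c Ws op cs
  | abs i, cs => ⟨tabsTM S h (getReg [] Ws i), cs, true⟩

/-- The real function pushed by a statement given the stack `fs`: what the underlying statement semantics `ev`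
pushes, or `t ↦ |vᵢ(t)|` (generic in the statement type `Op`, so that the unfolding lemmas below are keyed on the bare
constructors). [cite: Melquiond2008, Sect. 3.3] -/
noncomputable def evalF {Op : Type} (ev : List (ℝ → ℝ) → Op → ℝ → ℝ) (fs : List (ℝ → ℝ)) : AbsOp Op → ℝ → ℝ
  | base op => ev fs op
  | abs i => fun t => |getReg (fun _ => (0 : ℝ)) fs i t|

/-- A `base` statement pushes what it pushes in the underlying family. [cite: Melquiond2008, Sect. 3.3] -/
@[simp] theorem evalF_base {Op : Type} (ev : List (ℝ → ℝ) → Op → ℝ → ℝ) (fs : List (ℝ → ℝ)) (op : Op) :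
    evalF ev fs (base op) = ev fs op := rfl

/-- An `abs i` statement pushes `t ↦ |vᵢ(t)|`. [cite: MartindorelMelquiond2015, Sect. 4.3.3] -/
@[simp] theorem evalF_abs {Op : Type} (ev : List (ℝ → ℝ) → Op → ℝ → ℝ) (fs : List (ℝ → ℝ)) (i : ℕ) :
    evalF ev fs (abs i) = fun t => |getReg (fun _ => (0 : ℝ)) fs i t| := rfl

/-- [folklore] -/
private theorem measurable_evalF (F : OpSem M) {fs : List (ℝ → ℝ)}
    (hfs : ∀ i, Measurable (getReg (fun _ => (0 : ℝ)) fs i)) :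
    ∀ op : AbsOp M.Op, Measurable (evalF F.evalF fs op)
  | base op => F.measurable_evalF hfs op
  | abs i => continuous_abs.measurable.comp (hfs i)

/-- **Soundness of `AbsOp.model`** under the stack invariant. [cite: Joldes2011, Algorithm 2.2.10] [cite: MartindorelMelquiond2015, Sect. 4.3.3] -/
theorem tmem_model (F : OpSem M) (prm : M.Prm) {S : ℕ} (hS : 0 < S) {h : ℚ} (h0 : 0 ≤ h) (c : ℚ)
    {fs : List (ℝ → ℝ)} {Ws : List IPoly} (hst : StackMem S h c fs Ws) :
    ∀ (op : AbsOp M.Op) (cs : List (List ℤ × ℕ)), (model M prm S h c Ws op cs).ok = true →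
      TMem S h (fun u => evalF F.evalF fs op ((c : ℝ) + u)) (model M prm S h c Ws op cs).P
  | base op, cs, hok => F.tmem_model prm hS h0 c hst op cs hok
  | abs i, _, _ => tmem_abs hS h0 (hst i)

end AbsOp

/-- **The family transformer, computable half**: statements `AbsOp M.Op`, the parameters of `M`, modeller
`AbsOp.model`. [cite: Melquiond2008, Sect. 3.3] [cite: MartindorelMelquiond2015, Sect. 4.3.3] -/
abbrev OpModel.withAbs (M : OpModel) : OpModel :=
  ⟨AbsOp M.Op, M.Prm, fun prm S h c Ws op cs => AbsOp.model M prm S h c Ws op cs⟩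

/-- **The family transformer, semantic half**: semantics `AbsOp.evalF`, soundness `AbsOp.tmem_model` — so
`M.withAbs.certCheck` / `M.withAbs.panelCheck` certify integrals of programs with `abs` statements through
`F.withAbs.integral_bounds_of_certCheck` / `F.withAbs.fsegOK_of_panelCheck`. [cite: Melquiond2008, Sect. 3.3]
[cite: MartindorelMelquiond2015, Sect. 4.3.3] -/
noncomputable def OpSem.withAbs {M : OpModel} (F : OpSem M) : OpSem M.withAbs where
  evalF := AbsOp.evalF F.evalF
  measurable_evalF := fun hfs op => AbsOp.measurable_evalF F hfs op
  tmem_model := fun prm _ hS _ h0 c _ _ hst op cs hok => AbsOp.tmem_model F prm hS h0 c hst op cs hok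

/-- [folklore] -/
private theorem runF_withAbs_map {M : OpModel} (F : OpSem M) :
    ∀ (p : GProg M) (fs : List (ℝ → ℝ)), F.withAbs.runF (p.map AbsOp.base) fs = F.runF p fs
  | [], _ => rfl
  | _ :: p, _ => runF_withAbs_map F p _

/-- A program WITHOUT `abs` statements denotes, in the extended family, the function it denotes in the underlying
one (so the identification lemmas `toFunP_slp` / `toFunP_trig` / `toFunP_atan` … carry over).
[cite: MahboubiMelquiondSibutpinote2016, Sect. 4.1] -/
@[simp] theorem toFunP_withAbs_map {M : OpModel} (F : OpSem M) (p : GProg M) (ps : List ℝ) :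
    F.withAbs.toFunP (p.map AbsOp.base) ps = F.toFunP p ps := by
  unfold OpSem.toFunP; rw [runF_withAbs_map]

/-- The statement semantics of the extended family is `AbsOp.evalF F.evalF` (with `AbsOp.evalF_base` /
`AbsOp.evalF_abs`: for unfolding a certified `toFunP` to the integrand it denotes). [cite: Melquiond2008, Sect. 3.3] -/
@[simp] theorem withAbs_evalF {M : OpModel} (F : OpSem M) : F.withAbs.evalF = AbsOp.evalF F.evalF := rfl

end PolyMP

end Literature.Analysis.ValidatedNumerics
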